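import Summits.RiemannHypothesis.RiemannHypothesis.Theorems.SpectralTraceWindowStepStubModelDensity
import Summits.RiemannHypothesis.RiemannHypothesis.Theorems.SpectralTraceWindowStepStubModelRegular
import Summits.RiemannHypothesis.RiemannHypothesis.Theorems.WindowTraceArch.Negative.UnitMass
import Summits.RiemannHypothesis.RiemannHypothesis.Theorems.WindowTraceArch.Negative.LocalWeyl
import Summits.RiemannHypothesis.RiemannHypothesis.Theorems.WindowTraceArch.Negative.LocalWeylTools
import Literature.NumberTheory.LFunctions.WeilArchimedeanMoments
import Mathlib.Analysis.Calculus.BumpFunction.Normed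
import HarnessLib

/-!
# The sharp Christoffel cap for window families (line `conjugate-point`, RH-free)

Route `RiemannHypothesis/SpectralTrace`, crux `WindowStep` (stmt-RiemannHypothesis-14659), line
`conjugate-point`, in support of the registered stub `stub_coagulationDense` (the edge horn: at a
conjugate point `a`, no level-`2a` family whose multiplicities have positive upper logarithmic
density lies in the real zero set of a ground-state transform). This file proves the UPPER HALF of
the first-order balance defining the saturated residual of that stub, at every level and with no
hypothesis on `ε(a)`:

* `ncard_fibre_le_sharp` — **the sharp Christoffel cap.** For every `a > 0` and `η > 0` there is
  `X = X(a, η)` such that for EVERY real family `γ : ι → ℝ` reproducing the Weil functional on the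
  Weil tests supported in `[-2a, 2a]` and every `|x| ≥ X`, `#{i | γ i = x} ≤ (1/(2a) + η) log |x|`
  (uniform over families: `X` depends on `a, η` only);
* `coagulationDense_of_inv_lt` — hence the registered stub holds VACUOUSLY for every density
  parameter `δ > 1/(2a)`; its residual is `0 < δ ≤ 1/(2a)`.

Proof. (1) `card_mul_norm_sq_le_of_windowTrace`: for a Weil test `g` supported in `[-a, a]` and the
finite fibre `s = {i | γ i = x}` (`finite_abs_le_of_windowTrace`), `#s · |ĝ(1/2 + ix)|² ≤ Re Q(g)`.
(2) Test: the modulated plateau bump `g_x(t) = e^{-ixt} φ(t)` (`weilMellin_modulate`), `φ` a Mathlib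
`ContDiffBump 0` with `rIn = r := a/(1 + aη)`, `rOut = a`; `ĝ_x(1/2 + ix) = ∫ φ =: m ≥ 2r`,
`‖φ‖₂² ≤ m`. (3) `Re Q(g) = ∫ |ĝ(1/2 + iT)|² ρ_{2a}(T) dT` (`sharpCap_re_weilQuadratic_eq`: the
explicit window density `stub_modelDensity (2a)` tested against `g ⋆ g̃`,
`weilMellin_weilConv_weilReflect_half`) and POINTWISE `ρ_A(T) ≤ (1/2π) log(2 + |T|) + C_A`
(`sharpCap_modelDensity_le`: `stub_modelRegular_thetaDeriv_abs_le`, `stub_modelRegular_polar`,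
`stub_modelRegular_abs_sum_le`); with `log(2 + |T|) ≤ log(2 + |x|) + log(2 + |T − x|)`, `s = T − x`
and Plancherel (`integral_norm_sq_weilMellin_half_line`): `Re Q(g_x) ≤ ‖φ‖₂² log(2 + |x|) + K(φ, a)`
(`sharpCap_re_weilQuadratic_modulate_le`). (4) `#s ≤ log(2 + |x|)/m + K/m² ≤ (1/(2a) + η) log|x|`
for `|x| ≥ X(a, η)`. NOT here: the lower half of the balance along `Z_ℝ(û)` (the RH-bearing content
of `stub_coagulationDense`).
-/

set_option linter.dupNamespace false

noncomputable section

open Complex Set Filter MeasureTheory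
open scoped Real Topology

namespace Summit.RiemannHypothesis.RiemannHypothesis.Theorems.SpectralTraceWindowStep

open Literature.NumberTheory.LFunctions
open Summit.RiemannHypothesis.RiemannHypothesis.Theorems.FloorFeedback
open Summit.RiemannHypothesis.RiemannHypothesis.Theorems.WindowTraceArch.Negative

/-! ## §1 Pointwise upper bound for the explicit window density -/

/-- `log(2 + |T|) ≤ 2 + T²` (crude quadratic growth, for the integrability lemmas). [folklore] -/
theorem sharpCap_log_two_add_abs_le (T : ℝ) : Real.log (2 + |T|) ≤ 2 + T ^ 2 := by
  have h1 : Real.log (2 + |T|) ≤ (2 + |T|) - 1 := Real.log_le_sub_one_of_pos (by positivity)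
  nlinarith [abs_nonneg T, sq_abs T, sq_nonneg (|T| - 1)]

/-- Sharp one-sided Stirling bound for `θ′` on the whole line:
`θ′(T) ≤ ½ log(2 + |T|) + E` for all real `T` (`stub_modelRegular_thetaDeriv_abs_le` for `|T| ≥ 1`,
continuity of `θ′` on `[-1, 1]`). [folklore] -/
theorem sharpCap_thetaDeriv_le :
    ∃ E : ℝ, 0 ≤ E ∧ ∀ T : ℝ, riemannSiegelThetaDeriv T ≤ Real.log (2 + |T|) / 2 + E := by
  have hcont : Continuous riemannSiegelThetaDeriv := continuous_riemannSiegelThetaDeriv_holds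
  obtain ⟨K, hK⟩ :=
    isCompact_Icc.exists_bound_of_continuousOn (hcont.continuousOn (s := Icc (-1 : ℝ) 1))
  have hK0 : 0 ≤ max K 0 := le_max_right _ _
  have hl2π : 0 ≤ Real.log (2 * π) / 2 + 2 := by
    have := Real.log_nonneg (show (1 : ℝ) ≤ 2 * π by linarith [Real.pi_gt_three])
    linarith
  refine ⟨max K 0 + (Real.log (2 * π) / 2 + 2), add_nonneg hK0 hl2π, fun T => ?_⟩
  have hL0 : 0 ≤ Real.log (2 + |T|) := Real.log_nonneg (by linarith [abs_nonneg T])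
  rcases le_or_gt 1 |T| with hT | hT
  · have := (abs_le.1 (stub_modelRegular_thetaDeriv_abs_le hT)).2
    linarith
  · have hmem : T ∈ Icc (-1 : ℝ) 1 := ⟨(abs_lt.1 hT).1.le, (abs_lt.1 hT).2.le⟩
    have hθ : riemannSiegelThetaDeriv T ≤ max K 0 := by
      have h1 := hK T hmem
      rw [Real.norm_eq_abs] at h1
      exact ((le_abs_self _).trans h1).trans (le_max_left _ _)
    linarith

/-- **Pointwise cap on the window density.** For every level `A` there is `C = C(A) ≥ 0` with
`ρ_A(T) ≤ (1/2π) log(2 + |T|) + C` for ALL real `T` (`ρ_A = θ′/π + p_A − (1/π) Σ Λ(m) m^{-1/2} cos`: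
`sharpCap_thetaDeriv_le`, bounded polar kernel `stub_modelRegular_polar`, cosine sum bounded by
`Σ Λ(m)/√m`, `stub_modelRegular_abs_sum_le`). The constant `1/2π` is the sharp one. [folklore] -/
theorem sharpCap_modelDensity_le (A : ℝ) :
    ∃ C : ℝ, 0 ≤ C ∧ ∀ T : ℝ, modelDensity A T ≤ Real.log (2 + |T|) / (2 * π) + C := by
  obtain ⟨E, hE, hθ⟩ := sharpCap_thetaDeriv_le
  obtain ⟨c₂, hc₂⟩ := (stub_modelRegular_polar A).2.1
  have hc₂0 : 0 ≤ c₂ := (abs_nonneg _).trans (hc₂ 0)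
  have hM0 : 0 ≤ primeMass A := Finset.sum_nonneg fun m _ => stub_highZone_weight_nonneg m
  have hπ : 0 < π := Real.pi_pos
  refine ⟨E / π + c₂ + primeMass A / π, by positivity, fun T => ?_⟩
  unfold modelDensity primeMass
  set s := ∑ m ∈ weilPrimeIndex (A / 2),
      (ArithmeticFunction.vonMangoldt m : ℝ) / Real.sqrt m * Real.cos (T * Real.log m) with hs_def
  set M := ∑ m ∈ weilPrimeIndex (A / 2), (ArithmeticFunction.vonMangoldt m : ℝ) / Real.sqrt m
    with hM_def
  have hs : |s| ≤ M := stub_modelRegular_abs_sum_le _ _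
  have hs' : -s ≤ M := (neg_le_abs s).trans hs
  have h1 : riemannSiegelThetaDeriv T / π ≤ (Real.log (2 + |T|) / 2 + E) / π :=
    div_le_div_of_nonneg_right (hθ T) hπ.le
  have h2 : polarKernel A T ≤ c₂ := (le_abs_self _).trans (hc₂ T)
  have h3 : 1 / π * (-s) ≤ 1 / π * M := mul_le_mul_of_nonneg_left hs' (by positivity)
  have e1 : (Real.log (2 + |T|) / 2 + E) / π = Real.log (2 + |T|) / (2 * π) + E / π := by
    rw [add_div, div_div]
  have e2 : 1 / π * M = M / π := by ring
  have e3 : 1 / π * (-s) = -(1 / π * s) := by ring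
  linarith

/-- `T ↦ ‖ĝ(1/2 + iT)‖² ρ_A(T)` is integrable for every Weil test `g` (`ρ_A = O(log(2 + |T|))`,
`stub_modelRegular_bigO`, against the decay of `ĝ` on the line, `integrable_norm_sq_weilMellin_mul`).
[folklore] -/
theorem sharpCap_integrable_norm_sq_mul_modelDensity {g : ℝ → ℂ} (hg : IsWeilTest g) (A : ℝ) :
    Integrable fun T : ℝ => ‖weilMellin g (1 / 2 + T * I)‖ ^ 2 * modelDensity A T := by
  obtain ⟨C, hC⟩ := stub_modelRegular_bigO A
  have hC0 : 0 ≤ max C 0 := le_max_right _ _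
  refine integrable_norm_sq_weilMellin_mul hg (stub_modelRegular_continuous A).measurable
    (A := 2 * max C 0) (B := max C 0) (by positivity) hC0 fun T => ?_
  have hL0 : 0 ≤ Real.log (2 + |T|) := Real.log_nonneg (by linarith [abs_nonneg T])
  calc |modelDensity A T| ≤ C * Real.log (2 + |T|) := hC T
    _ ≤ max C 0 * Real.log (2 + |T|) := mul_le_mul_of_nonneg_right (le_max_left _ _) hL0
    _ ≤ max C 0 * (2 + T ^ 2) := mul_le_mul_of_nonneg_left (sharpCap_log_two_add_abs_le T) hC0
    _ = 2 * max C 0 + max C 0 * T ^ 2 := by ring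

/-! ## §2 The energy of a half-window test as an integral against the density -/

/-- **Density form of the energy.** For a Weil test `g` supported in `[-a, a]` (`a > 0`),
`Re Q(g) = ∫ |ĝ(1/2 + iT)|² ρ_{2a}(T) dT`: the explicit window density at level `2a`
(`stub_modelDensity`) tested against `g ⋆ g̃` (a Weil test supported in `[-2a, 2a]`,
`tsupport_weilConv_weilReflect_subset`), whose transform on the critical line is `|ĝ(1/2 + iT)|²`
(`weilMellin_weilConv_weilReflect_half`). [folklore] -/
theorem sharpCap_re_weilQuadratic_eq {a : ℝ} (ha : 0 < a) {g : ℝ → ℂ} (hg : IsWeilTest g)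
    (hgs : tsupport g ⊆ Icc (-a) a) :
    (weilQuadratic g).re =
      ∫ T : ℝ, ‖weilMellin g (1 / 2 + T * I)‖ ^ 2 * modelDensity (2 * a) T := by
  have hk : IsWeilTest (weilConv g (weilReflect g)) := hg.weilConv hg.weilReflect
  have hks : tsupport (weilConv g (weilReflect g)) ⊆ Icc (-(2 * a)) (2 * a) :=
    tsupport_weilConv_weilReflect_subset hg.2 hgs
  obtain ⟨-, hW⟩ := stub_modelDensity (2 * a) (by positivity) _ hk hks
  unfold weilQuadratic
  rw [← hW]
  simp_rw [weilMellin_weilConv_weilReflect_half hg, ← Complex.ofReal_mul]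
  rw [integral_complex_ofReal, Complex.ofReal_re]

/-! ## §3 The energy of a modulated half-window test -/

/-- **Energy of a modulated test.** For a Weil test `φ` supported in `[-a, a]` (`a > 0`) there is
`K = K(φ, a) ≥ 0` such that for every real `x` the modulated test `φ_x(t) = e^{-ixt} φ(t)` has
`Re Q(φ_x) ≤ ‖φ‖₂² · log(2 + |x|) + K`. (Density form `sharpCap_re_weilQuadratic_eq`;
`|φ̂_x(1/2 + iT)|² = |φ̂(1/2 + i(T − x))|²`, `weilMellin_modulate`; the pointwise cap
`sharpCap_modelDensity_le` with `log(2 + |T|) ≤ log(2 + |x|) + log(2 + |T − x|)`; translation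
invariance; Plancherel `integral_norm_sq_weilMellin_half_line`.) [folklore] -/
theorem sharpCap_re_weilQuadratic_modulate_le {a : ℝ} (ha : 0 < a) {φ : ℝ → ℂ}
    (hφ : IsWeilTest φ) (hφs : tsupport φ ⊆ Icc (-a) a) :
    ∃ K : ℝ, 0 ≤ K ∧ ∀ x : ℝ,
      (weilQuadratic (fun t : ℝ => cexp (-((x * t : ℝ) : ℂ) * I) * φ t)).re ≤
        weilNorm2Sq φ * Real.log (2 + |x|) + K := by
  obtain ⟨C, hC0, hC⟩ := sharpCap_modelDensity_le (2 * a)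
  -- the weight `G(s) = log(2 + |s|)/(2π) + C` and the constant `K = ∫ |φ̂(1/2 + is)|² G(s) ds`
  set G : ℝ → ℝ := fun s => Real.log (2 + |s|) / (2 * π) + C with hG
  have hGm : Measurable G := by
    rw [hG]
    fun_prop
  have hG0 : ∀ s, 0 ≤ G s := fun s => by
    have : 0 ≤ Real.log (2 + |s|) := Real.log_nonneg (by linarith [abs_nonneg s])
    positivity
  have hGb : ∀ s, |G s| ≤ (2 + C) + 1 * s ^ 2 := fun s => by
    rw [abs_of_nonneg (hG0 s)]
    have h1 := sharpCap_log_two_add_abs_le s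
    have h2 : Real.log (2 + |s|) / (2 * π) ≤ Real.log (2 + |s|) := by
      refine div_le_self (Real.log_nonneg (by linarith [abs_nonneg s])) ?_
      linarith [Real.pi_gt_three]
    simp only [hG]
    linarith
  set K : ℝ := ∫ s : ℝ, ‖weilMellin φ (1 / 2 + s * I)‖ ^ 2 * G s with hK
  have hKi : Integrable fun s : ℝ => ‖weilMellin φ (1 / 2 + s * I)‖ ^ 2 * G s :=
    integrable_norm_sq_weilMellin_mul hφ hGm (by positivity) zero_le_one hGb
  have hK0 : 0 ≤ K := integral_nonneg fun s => mul_nonneg (sq_nonneg _) (hG0 s)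
  refine ⟨K, hK0, fun x => ?_⟩
  set L : ℝ := Real.log (2 + |x|) / (2 * π) with hL
  have hlx0 : 0 ≤ Real.log (2 + |x|) := Real.log_nonneg (by linarith [abs_nonneg x])
  have hL0 : 0 ≤ L := by positivity
  set φx : ℝ → ℂ := fun t => cexp (-((x * t : ℝ) : ℂ) * I) * φ t with hφx
  have hφxW : IsWeilTest φx := isWeilTest_modulate hφ x
  have hφxs : tsupport φx ⊆ Icc (-a) a := (tsupport_modulate_subset φ x).trans hφs
  rw [sharpCap_re_weilQuadratic_eq ha hφxW hφxs]
  have hpt : ∀ T : ℝ, ‖weilMellin φx (1 / 2 + T * I)‖ ^ 2 * modelDensity (2 * a) T ≤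
      ‖weilMellin φ (1 / 2 + ((T - x : ℝ) : ℂ) * I)‖ ^ 2 * (L + G (T - x)) := by
    intro T
    have e : weilMellin φx (1 / 2 + T * I) = weilMellin φ (1 / 2 + ((T - x : ℝ) : ℂ) * I) :=
      weilMellin_modulate φ x T
    rw [e]
    refine mul_le_mul_of_nonneg_left ?_ (sq_nonneg _)
    have h1 := hC T
    have h2 : Real.log (2 + |T|) ≤ Real.log (2 + |x|) + Real.log (2 + |T - x|) := by
      rw [← Real.log_mul (by positivity) (by positivity)]
      refine Real.log_le_log (by positivity) ?_
      have : |T| ≤ |x| + |T - x| := by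
        have := abs_add_le x (T - x)
        simpa using this
      nlinarith [abs_nonneg (T - x), abs_nonneg x]
    have h3 : Real.log (2 + |T|) / (2 * π) ≤
        Real.log (2 + |x|) / (2 * π) + Real.log (2 + |T - x|) / (2 * π) := by
      rw [← add_div]
      exact div_le_div_of_nonneg_right h2 (by positivity)
    simp only [hG, hL]
    linarith
  have hi1 : Integrable fun T : ℝ =>
      ‖weilMellin φx (1 / 2 + T * I)‖ ^ 2 * modelDensity (2 * a) T :=
    sharpCap_integrable_norm_sq_mul_modelDensity hφxW (2 * a)
  have e0 : (fun s : ℝ => ‖weilMellin φ (1 / 2 + s * I)‖ ^ 2 * (L + G s)) =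
      fun s : ℝ => L * ‖weilMellin φ (1 / 2 + s * I)‖ ^ 2 +
        ‖weilMellin φ (1 / 2 + s * I)‖ ^ 2 * G s := by
    funext s; ring
  have hi0 : Integrable fun s : ℝ => ‖weilMellin φ (1 / 2 + s * I)‖ ^ 2 * (L + G s) := by
    rw [e0]
    exact ((integrable_norm_sq_weilMellin_half_line hφ).const_mul L).add hKi
  have hi2 : Integrable fun T : ℝ =>
      ‖weilMellin φ (1 / 2 + ((T - x : ℝ) : ℂ) * I)‖ ^ 2 * (L + G (T - x)) := by
    have := hi0.comp_sub_right x
    exact this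
  calc ∫ T : ℝ, ‖weilMellin φx (1 / 2 + T * I)‖ ^ 2 * modelDensity (2 * a) T
      ≤ ∫ T : ℝ, ‖weilMellin φ (1 / 2 + ((T - x : ℝ) : ℂ) * I)‖ ^ 2 * (L + G (T - x)) :=
        integral_mono hi1 hi2 hpt
    _ = ∫ s : ℝ, ‖weilMellin φ (1 / 2 + s * I)‖ ^ 2 * (L + G s) := by
        have := integral_sub_right_eq_self (μ := (volume : Measure ℝ))
          (fun s : ℝ => ‖weilMellin φ (1 / 2 + s * I)‖ ^ 2 * (L + G s)) x
        simpa using this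
    _ = L * (2 * π * weilNorm2Sq φ) + K := by
        rw [e0, integral_add ((integrable_norm_sq_weilMellin_half_line hφ).const_mul L) hKi,
          MeasureTheory.integral_const_mul, integral_norm_sq_weilMellin_half_line hφ]
    _ = weilNorm2Sq φ * Real.log (2 + |x|) + K := by
        rw [hL]
        field_simp

/-! ## §4 Multiplicity versus energy -/

/-- **Multiplicity bound for the modulated test.** For a level-`2a` window family `γ`, a Weil
test `φ` supported in `[-a, a]` and a real `x`: the fibre `{i | γ i = x}` is finite
(`finite_abs_le_of_windowTrace`) and `#{i | γ i = x} · |φ̂(1/2)|² ≤ Re Q(φ_x)` for the modulated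
test `φ_x(t) = e^{-ixt} φ(t)` (`card_mul_norm_sq_le_of_windowTrace`, `φ̂_x(1/2 + ix) = φ̂(1/2)`).
[folklore] -/
theorem sharpCap_ncard_mul_le {a : ℝ} (ha : 0 < a) {ι : Type*} {γ : ι → ℝ}
    (h : ∀ g : ℝ → ℂ, IsWeilTest g → tsupport g ⊆ Icc (-(2 * a)) (2 * a) →
      HasSum (fun i => weilMellin g (1 / 2 + (γ i : ℂ) * I)) (weilFunctional g))
    {φ : ℝ → ℂ} (hφ : IsWeilTest φ) (hφs : tsupport φ ⊆ Icc (-a) a) (x : ℝ) :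
    {i : ι | γ i = x}.Finite ∧
      ({i : ι | γ i = x}.ncard : ℝ) * ‖weilMellin φ (1 / 2)‖ ^ 2 ≤
        (weilQuadratic (fun t : ℝ => cexp (-((x * t : ℝ) : ℂ) * I) * φ t)).re := by
  have h2a : (0 : ℝ) < 2 * a := by positivity
  have hfin : {i : ι | γ i = x}.Finite :=
    (finite_abs_le_of_windowTrace h2a h |x|).subset fun i hi => by
      simp only [Set.mem_setOf_eq] at hi ⊢
      rw [hi]
  refine ⟨hfin, ?_⟩
  set φx : ℝ → ℂ := fun t => cexp (-((x * t : ℝ) : ℂ) * I) * φ t with hφx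
  have hφxW : IsWeilTest φx := isWeilTest_modulate hφ x
  have hφxs : tsupport φx ⊆ Icc (-(2 * a / 2)) (2 * a / 2) :=
    (tsupport_modulate_subset φ x).trans (by rw [show 2 * a / 2 = a by ring]; exact hφs)
  have hcard := card_mul_norm_sq_le_of_windowTrace h hφxW hφxs hfin.toFinset
    (fun i hi => hfin.mem_toFinset.1 hi)
  have e : weilMellin φx (1 / 2 + (x : ℂ) * I) = weilMellin φ (1 / 2) := by
    have e1 : weilMellin φx (1 / 2 + (x : ℂ) * I) =
        weilMellin φ (1 / 2 + ((x - x : ℝ) : ℂ) * I) := weilMellin_modulate φ x x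
    rw [e1]
    simp
  rw [Set.ncard_eq_toFinset_card _ hfin, ← e]
  exact hcard

/-! ## §5 The plateau bump and the sharp cap -/

/-- **The sharp Christoffel cap (RH-free, every level, uniform over families).** For every
`a > 0` and `η > 0` there is `X = X(a, η)` such that: if a real family `γ : ι → ℝ` reproduces the
Weil functional on the Weil tests supported in `[-2a, 2a]`, then for every real `x` with `|x| ≥ X`
the multiplicity of the value `x` satisfies `#{i | γ i = x} ≤ (1/(2a) + η) log |x|`. (Test the trace
identity against the modulated plateau bump `e^{-ixt} φ(t)`, `φ ≡ 1` on `[-r, r]`, `r = a/(1 + aη)`,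
`supp φ ⊆ [-a, a]`: multiplicity `× (∫ φ)² ≤ Re Q ≤ ‖φ‖₂² log(2 + |x|) + K ≤ (∫ φ) log(2 + |x|) + K`,
and `∫ φ ≥ 2r`.) This is the upper half of the first-order balance `#{i | γ i = x} ∼ log|x|/(2a)`
that a violator of `stub_coagulationDense` must saturate. [folklore] -/
theorem ncard_fibre_le_sharp :
    ∀ a : ℝ, 0 < a → ∀ η : ℝ, 0 < η → ∃ X : ℝ, ∀ (ι : Type) (γ : ι → ℝ),
      (∀ g : ℝ → ℂ, Literature.NumberTheory.LFunctions.IsWeilTest g →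
        tsupport g ⊆ Set.Icc (-(2 * a)) (2 * a) →
          HasSum (fun i => Literature.NumberTheory.LFunctions.weilMellin g (1 / 2 + (γ i : ℂ) * Complex.I))
            (Literature.NumberTheory.LFunctions.weilFunctional g)) →
      ∀ x : ℝ, X ≤ |x| → ({i : ι | γ i = x}.ncard : ℝ) ≤ (1 / (2 * a) + η) * Real.log |x| := by
  intro a ha η hη
  -- the plateau bump: `≡ 1` on `[-r, r]`, supported in `[-a, a]`, `r = a/(1 + aη)`
  set r : ℝ := a / (1 + a * η) with hr
  have hr0 : 0 < r := by positivity
  have hra : r < a := by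
    rw [hr, div_lt_iff₀ (by positivity)]
    nlinarith [mul_pos (mul_pos ha ha) hη]
  have hrinv : 1 / (2 * r) = 1 / (2 * a) + η / 2 := by
    rw [hr]
    field_simp
  let b : ContDiffBump (0 : ℝ) := ⟨r, a, hr0, hra⟩
  set φ : ℝ → ℂ := fun t => ((b t : ℝ) : ℂ) with hφ_def
  have hφ : IsWeilTest φ :=
    ⟨Complex.ofRealCLM.contDiff.comp b.contDiff, b.hasCompactSupport.comp_left Complex.ofReal_zero⟩
  have hφs : tsupport φ ⊆ Icc (-a) a := by
    refine (tsupport_comp_subset Complex.ofReal_zero _).trans ?_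
    rw [b.tsupport_eq, Real.closedBall_eq_Icc, zero_sub, zero_add]
  set m : ℝ := ∫ t, b t with hm
  have hm2r : 2 * r ≤ m := by
    have hmeas : (volume : Measure ℝ).real (Metric.closedBall (0 : ℝ) r) ≤ m :=
      b.measure_closedBall_le_integral volume
    rwa [Real.volume_real_closedBall hr0.le] at hmeas
  have hm0 : 0 < m := by linarith
  have hmel : weilMellin φ (1 / 2) = (m : ℂ) := by
    unfold weilMellin
    rw [hm, ← integral_complex_ofReal]
    congr 1 with t
    simp [hφ_def]
  have hN2 : weilNorm2Sq φ ≤ m := by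
    unfold weilNorm2Sq
    rw [hm]
    refine integral_mono_of_nonneg (Eventually.of_forall fun t => by positivity) b.integrable
      (Eventually.of_forall fun t => ?_)
    have h0 : 0 ≤ b t := b.nonneg
    have h1 : b t ≤ 1 := b.le_one
    simp only [hφ_def, Complex.norm_real, Real.norm_eq_abs, abs_of_nonneg h0]
    nlinarith
  obtain ⟨K, hK0, hK⟩ := sharpCap_re_weilQuadratic_modulate_le ha hφ hφs
  set D : ℝ := (1 / (2 * a) + η / 2) * Real.log 2 + K / m ^ 2 with hD
  refine ⟨max 2 (Real.exp (2 * D / η)), fun ι γ hγ x hx => ?_⟩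
  have hx2 : 2 ≤ |x| := (le_max_left _ _).trans hx
  have hx0 : 0 < |x| := by linarith
  have hxD : 2 * D / η ≤ Real.log |x| := by
    have h1 : Real.exp (2 * D / η) ≤ |x| := (le_max_right _ _).trans hx
    rw [← Real.log_exp (2 * D / η)]
    exact Real.log_le_log (Real.exp_pos _) h1
  have hlog2x : Real.log (2 + |x|) ≤ Real.log 2 + Real.log |x| := by
    rw [← Real.log_mul two_ne_zero hx0.ne']
    exact Real.log_le_log (by positivity) (by linarith)
  have hlog0 : 0 ≤ Real.log (2 + |x|) := Real.log_nonneg (by linarith)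
  obtain ⟨-, hmult⟩ := sharpCap_ncard_mul_le ha hγ hφ hφs x
  rw [hmel, Complex.norm_real, Real.norm_eq_abs, abs_of_pos hm0] at hmult
  have hQ := hK x
  have h1 : ({i : ι | γ i = x}.ncard : ℝ) * m ^ 2 ≤ m * Real.log (2 + |x|) + K := by
    have := mul_le_mul_of_nonneg_right hN2 hlog0
    linarith
  have hκ : 1 / m ≤ 1 / (2 * a) + η / 2 := by
    rw [← hrinv]
    exact one_div_le_one_div_of_le (by positivity) hm2r
  have h2 : ({i : ι | γ i = x}.ncard : ℝ) ≤ (m * Real.log (2 + |x|) + K) / m ^ 2 := by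
    rw [le_div_iff₀ (by positivity)]
    exact h1
  have h3 : (m * Real.log (2 + |x|) + K) / m ^ 2 = 1 / m * Real.log (2 + |x|) + K / m ^ 2 := by
    field_simp
  have h4 : 1 / m * Real.log (2 + |x|) ≤ (1 / (2 * a) + η / 2) * Real.log (2 + |x|) :=
    mul_le_mul_of_nonneg_right hκ hlog0
  have h5 : (1 / (2 * a) + η / 2) * Real.log (2 + |x|) ≤
      (1 / (2 * a) + η / 2) * (Real.log 2 + Real.log |x|) :=
    mul_le_mul_of_nonneg_left hlog2x (by positivity)
  have h6 : D ≤ η / 2 * Real.log |x| := by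
    have := (div_le_iff₀ hη).1 hxD
    linarith
  calc ({i : ι | γ i = x}.ncard : ℝ) ≤ 1 / m * Real.log (2 + |x|) + K / m ^ 2 := by
        rw [← h3]; exact h2
    _ ≤ (1 / (2 * a) + η / 2) * (Real.log 2 + Real.log |x|) + K / m ^ 2 := by linarith
    _ = (1 / (2 * a) + η / 2) * Real.log |x| + D := by rw [hD]; ring
    _ ≤ (1 / (2 * a) + η) * Real.log |x| := by linarith

/-- **Corollary: the registered edge stub holds vacuously above the Christoffel slope.** For
`a > 0` and a density parameter `δ > 1/(2a)`, NO level-`2a` window family has multiplicities of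
upper logarithmic density `≥ δ` (`ncard_fibre_le_sharp` with `η = (δ − 1/(2a))/2`); hence the
conclusion of `stub_coagulationDense` holds for such `δ` with no hypothesis on `ε(a)` or on `u`.
The residual of the stub is `0 < δ ≤ 1/(2a)`. [folklore] -/
theorem coagulationDense_of_inv_lt :
    ∀ a : ℝ, 0 < a → ∀ u : ℝ → ℂ, ∀ (ι : Type) (γ : ι → ℝ) (δ : ℝ), 1 / (2 * a) < δ →
      (∀ X : ℝ, ∃ x : ℝ, X ≤ |x| ∧ δ * Real.log |x| < ({i : ι | γ i = x}.ncard : ℝ)) →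
      (∀ g : ℝ → ℂ, Literature.NumberTheory.LFunctions.IsWeilTest g →
        tsupport g ⊆ Set.Icc (-(2 * a)) (2 * a) →
          HasSum (fun i => Literature.NumberTheory.LFunctions.weilMellin g (1 / 2 + (γ i : ℂ) * Complex.I))
            (Literature.NumberTheory.LFunctions.weilFunctional g)) →
      ∃ i : ι, Literature.NumberTheory.LFunctions.weilMellin u (1 / 2 + (γ i : ℂ) * Complex.I) ≠ 0 := by
  intro a ha u ι γ δ hδ hdense hγ
  exfalso
  set η : ℝ := (δ - 1 / (2 * a)) / 2 with hη
  have hη0 : 0 < η := by rw [hη]; linarith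
  obtain ⟨X, hX⟩ := ncard_fibre_le_sharp a ha η hη0
  obtain ⟨x, hx, hlt⟩ := hdense (max X 1)
  have hxX : X ≤ |x| := (le_max_left _ _).trans hx
  have hx1 : 1 ≤ |x| := (le_max_right _ _).trans hx
  have hlog : 0 ≤ Real.log |x| := Real.log_nonneg hx1
  have hcap := hX ι γ hγ x hxX
  have hle : (1 / (2 * a) + η) * Real.log |x| ≤ δ * Real.log |x| :=
    mul_le_mul_of_nonneg_right (by rw [hη]; linarith) hlog
  linarith

end Summit.RiemannHypothesis.RiemannHypothesis.Theorems.SpectralTraceWindowStep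

end
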